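import Summits.AtomisticToContinuum.FouriersLaw.Theorems.PhononMeanFreePathCoherentDephasingResponseStatics
import Summits.AtomisticToContinuum.FouriersLaw.Theorems.BondHeatUncertaintyLightConeBondHeatGibbsByParts
import Summits.AtomisticToContinuum.FouriersLaw.Theorems.PhononMeanFreePathCoherentDephasingHeadBound
import Summits.AtomisticToContinuum.FouriersLaw.Theorems.OddSectorIrreversibilitySubBallisticWindowStaticCurrentBound

/-!
# Strict absorption, sub-goal K4b: Gaussian-momentum statics of the Gibbs measure

Registered stub `sa_statics` of line `Sketch` of crux `PhononMeanFreePath.CoherentDephasing`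
(stmt-AtomisticToContinuum-11810), lead skeleton `StrictAbsorption`. Under the Gibbs measure `μ = Z⁻¹ e^{-H/T} dq dp`
(`T > 0`) of the `(N+1)`-site pinned chain `pinnedChain ω₂ lam β γ` the momenta are i.i.d. centred Gaussians of variance
`T`, independent of the positions. With `Φ = ω₂ + 3 lam q₀² + 1 + 3β (q₁ - q₀)²`, `Φ̃ = Φ - ∫ Φ dμ`, the which-path
witness `a = p₀ Φ̃` and the generator images `G₁ = L p₀`, `G₂ = L G₁` (explicit polynomials), the four identities
`⟨a, p₀⟩ = 0`, `⟨a, G₁⟩ = 0`, `⟨a, G₂⟩ = -T ∫ Φ̃²`, `‖a‖² = T ∫ Φ̃²` reduce to `∫ p₀ g(q) dμ = 0` (momentum reversal),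
`∫ p₀ p₁ g(q) dμ = 0` and `∫ p₀² g(q) dμ = T ∫ g(q) dμ` (Gaussian integration by parts in `p₀`, tree files
`…LightConeBondHeatGibbsByParts`, `…SubBallisticWindowStaticCurrentBound`) for polynomially bounded continuous `g(q)`.
They are first proved for abstract position observables `Φ, h = O(1+H)`, `g, k = O((1+H)²)` (`statics_identities`).
-/

noncomputable section

open MeasureTheory ProbabilityTheory Filter Topology Set
open scoped NNReal ENNReal

namespace Summit.AtomisticToContinuum.FouriersLaw.Theorems.CoherentDephasing.StrictAbsorption

open Literature.MathematicalPhysics.KineticTheory.HeatConduction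
open Literature.MathematicalPhysics.KineticTheory Literature.Probability.Process OscillatorChain
open Summit.AtomisticToContinuum.FouriersLaw.Theorems.PhononMeanFreePath
open Summit.AtomisticToContinuum.FouriersLaw.Theorems.SubdiffusiveBondHeat
open Summit.AtomisticToContinuum.FouriersLaw.Theorems.LightConeBondHeat
open Summit.AtomisticToContinuum.FouriersLaw.Theorems.SubBallisticWindow.StaticCurrentBound
open Summit.AtomisticToContinuum.FouriersLaw.Theorems.CoherentDephasing.MeanFieldDuhamel

/-! ### Elementary bookkeeping of polynomial energy bounds -/

/-- Product rule for bounds `|a| ≤ A X^i`, `|b| ≤ B X^j`: `|ab| ≤ AB X^(i+j)`. [folklore] -/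
theorem statics_abs_mul_le {a b A B X : ℝ} {i j : ℕ} (ha : |a| ≤ A * X ^ i) (hb : |b| ≤ B * X ^ j) :
    |a * b| ≤ A * B * X ^ (i + j) := by
  rw [abs_mul, pow_add]
  have hA : 0 ≤ A * X ^ i := (abs_nonneg a).trans ha
  calc |a| * |b| ≤ (A * X ^ i) * (B * X ^ j) := mul_le_mul ha hb (abs_nonneg b) hA
    _ = A * B * (X ^ i * X ^ j) := by ring

/-- Raising the exponent in a bound `|a| ≤ A X^i` when `X ≥ 1`. [folklore] -/
theorem statics_abs_le_pow_mono {a A X : ℝ} {i j : ℕ} (hX : 1 ≤ X) (hij : i ≤ j) (ha : |a| ≤ A * X ^ i) :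
    |a| ≤ A * X ^ j := by
  have hXi : 0 < X ^ i := pow_pos (by linarith) i
  have hA : 0 ≤ A := le_of_mul_le_mul_right (by simpa using (abs_nonneg a).trans ha) hXi
  exact ha.trans (mul_le_mul_of_nonneg_left (pow_le_pow_right₀ hX hij) hA)

section Tools

variable {ω₂ lam β : ℝ} (hω : 0 < ω₂) (hl : 0 ≤ lam) (hβ : 0 ≤ β) (γ : ℝ) (n : ℕ) {T : ℝ} (hT : 0 < T)
include hω hl hβ hT

/-- A continuous observable dominated by `C (1+H)^m` is integrable for the Gibbs measure `μ_T` of the pinned chain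
(`T > 0`). [folklore] -/
theorem statics_integrable_of_le_pow (m : ℕ) {f : PhaseSpace n → ℝ} (hf : Continuous f) {C : ℝ}
    (hle : ∀ z, |f z| ≤ C * (1 + (pinnedChain ω₂ lam β γ).hamiltonian n z) ^ m) :
    Integrable f ((pinnedChain ω₂ lam β γ).gibbsMeasure n T) :=
  (pinnedChain ω₂ lam β γ).integrable_gibbsMeasure
    (pinnedChain_integrable_mul_gibbsDensity_of_le_pow hω hl hβ γ n hT m hf hle)

omit hω hl hβ hT in
/-- `∫ p_j G(q) dμ_T = 0` for every function `G` of the positions: the integrand is odd under the momentum reversal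
`(q, p) ↦ (q, -p)`, which preserves `e^{-H/T} dq dp` (no integrability needed). [folklore] -/
theorem statics_integral_momentum_mul_posFun (T : ℝ) (j : Fin n) (G : (Fin n → ℝ) → ℝ) :
    ∫ z, z.2 j * G z.1 ∂((pinnedChain ω₂ lam β γ).gibbsMeasure n T) = 0 := by
  rw [(pinnedChain ω₂ lam β γ).integral_gibbsMeasure]
  have h := integral_comp_momentumReversal n fun x =>
    x.2 j * G x.1 * (pinnedChain ω₂ lam β γ).gibbsDensity n T x
  simp only [OscillatorChain.gibbsDensity, OscillatorChain.hamiltonian_neg_momentum, Pi.neg_apply,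
    neg_mul, integral_neg] at h
  have h0 : ∫ x, x.2 j * G x.1 * (pinnedChain ω₂ lam β γ).gibbsDensity n T x = 0 := by
    simp only [OscillatorChain.gibbsDensity]
    linarith
  rw [h0, mul_zero]

/-- **Gaussian second moment with a configurational weight**: `∫ p_j² G(q) dμ_T = T ∫ G(q) dμ_T` for continuous
`G = O((1+H)²)` (the tree's `pinnedChain_integral_momentum_sq_mul_posFun`, normalised). [folklore] -/
theorem statics_integral_momentum_sq_mul_posFun (j : Fin n) {G : (Fin n → ℝ) → ℝ} (hG : Continuous G) {C : ℝ}
    (hGle : ∀ z : PhaseSpace n, |G z.1| ≤ C * (1 + (pinnedChain ω₂ lam β γ).hamiltonian n z) ^ 2) :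
    ∫ z, z.2 j ^ 2 * G z.1 ∂((pinnedChain ω₂ lam β γ).gibbsMeasure n T) =
      T * ∫ z, G z.1 ∂((pinnedChain ω₂ lam β γ).gibbsMeasure n T) := by
  rw [(pinnedChain ω₂ lam β γ).integral_gibbsMeasure, (pinnedChain ω₂ lam β γ).integral_gibbsMeasure,
    pinnedChain_integral_momentum_sq_mul_posFun hω hl hβ γ n hT j hG hGle]
  ring

/-- **Mixed momenta are uncorrelated given the positions**: `∫ p_j p_i G(q) dμ_T = 0` for `i ≠ j` and continuous
`G = O((1+H)²)` (Gaussian integration by parts in `p_j`; `∂_{p_j} (p_i G(q)) = 0`). [folklore] -/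
theorem statics_integral_momentum_mul_momentum_mul_posFun {j i : Fin n} (hij : i ≠ j) {G : (Fin n → ℝ) → ℝ}
    (hG : Continuous G) {C : ℝ}
    (hGle : ∀ z : PhaseSpace n, |G z.1| ≤ C * (1 + (pinnedChain ω₂ lam β γ).hamiltonian n z) ^ 2) :
    ∫ z, z.2 j * z.2 i * G z.1 ∂((pinnedChain ω₂ lam β γ).gibbsMeasure n T) = 0 := by
  rw [(pinnedChain ω₂ lam β γ).integral_gibbsMeasure]
  have hF : Continuous fun z : PhaseSpace n => z.2 i * G z.1 :=
    (by fun_prop : Continuous fun z : PhaseSpace n => z.2 i).mul (hG.comp continuous_fst)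
  have hinv : ∀ (z : PhaseSpace n) (t : ℝ), (fun z : PhaseSpace n => z.2 i * G z.1)
      (z + t • ((0, Pi.single j 1) : PhaseSpace n)) = (fun z : PhaseSpace n => z.2 i * G z.1) z := by
    intro z t
    simp [hij]
  have hle : ∀ z : PhaseSpace n, |(fun z : PhaseSpace n => z.2 i * G z.1) z| ≤
      C * (1 + (pinnedChain ω₂ lam β γ).hamiltonian n z) ^ 3 := by
    intro z
    have hH0 := pinnedChain_hamiltonian_nonneg hω.le hl hβ γ n z
    have hC0 : 0 ≤ C * (1 + (pinnedChain ω₂ lam β γ).hamiltonian n z) ^ 2 := (abs_nonneg _).trans (hGle z)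
    simp only
    rw [abs_mul]
    calc |z.2 i| * |G z.1| ≤ (1 + (pinnedChain ω₂ lam β γ).hamiltonian n z) *
          (C * (1 + (pinnedChain ω₂ lam β γ).hamiltonian n z) ^ 2) :=
          mul_le_mul (abs_momentum_le hω.le hl hβ γ n z i) (hGle z) (abs_nonneg _) (by positivity)
      _ = C * (1 + (pinnedChain ω₂ lam β γ).hamiltonian n z) ^ 3 := by ring
  have h := integral_momentum_mul_eq_zero hω hl hβ γ n hT j hF hinv hle
  have e : ∫ z, z.2 j * z.2 i * G z.1 * (pinnedChain ω₂ lam β γ).gibbsDensity n T z =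
      ∫ z, z.2 j * (fun z : PhaseSpace n => z.2 i * G z.1) z * (pinnedChain ω₂ lam β γ).gibbsDensity n T z :=
    integral_congr_ae (Eventually.of_forall fun z => by simp only; ring)
  rw [e, h, mul_zero]

/-- **The four Gaussian-momentum identities, abstract form.** For continuous position observables
`Φ, h = O(1+H)` and `g, k = O((1+H)²)`, momenta `p_j ≠ p_i`, `c = ∫ Φ dμ_T` and `a = p_j (Φ - c)`:
`∫ a p_j = 0`, `∫ a (g - γ' p_j) = 0`, `∫ a (-(p_j Φ) + p_i h + γ' k + γ'² p_j) = -T ∫ (Φ - c)²`,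
`∫ a² = T ∫ (Φ - c)²`. [folklore] -/
theorem statics_identities {j i : Fin n} (hij : i ≠ j) {Φ g h k : (Fin n → ℝ) → ℝ}
    (hΦc : Continuous Φ) (hgc : Continuous g) (hhc : Continuous h) (hkc : Continuous k) {C : ℝ}
    (hΦ : ∀ z : PhaseSpace n, |Φ z.1| ≤ C * (1 + (pinnedChain ω₂ lam β γ).hamiltonian n z))
    (hh : ∀ z : PhaseSpace n, |h z.1| ≤ C * (1 + (pinnedChain ω₂ lam β γ).hamiltonian n z))
    (hg : ∀ z : PhaseSpace n, |g z.1| ≤ C * (1 + (pinnedChain ω₂ lam β γ).hamiltonian n z) ^ 2)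
    (hk : ∀ z : PhaseSpace n, |k z.1| ≤ C * (1 + (pinnedChain ω₂ lam β γ).hamiltonian n z) ^ 2)
    (γ' : ℝ) {c : ℝ} (hc : c = ∫ x, Φ x.1 ∂((pinnedChain ω₂ lam β γ).gibbsMeasure n T)) :
    (∫ z, (z.2 j * (Φ z.1 - c)) * z.2 j ∂((pinnedChain ω₂ lam β γ).gibbsMeasure n T) = 0) ∧
    (∫ z, (z.2 j * (Φ z.1 - c)) * (g z.1 - γ' * z.2 j) ∂((pinnedChain ω₂ lam β γ).gibbsMeasure n T) = 0) ∧
    (∫ z, (z.2 j * (Φ z.1 - c)) * (-(z.2 j * Φ z.1) + z.2 i * h z.1 + γ' * k z.1 + γ' ^ 2 * z.2 j)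
        ∂((pinnedChain ω₂ lam β γ).gibbsMeasure n T) =
      -(T * ∫ z, (Φ z.1 - c) ^ 2 ∂((pinnedChain ω₂ lam β γ).gibbsMeasure n T))) ∧
    (∫ z, (z.2 j * (Φ z.1 - c)) ^ 2 ∂((pinnedChain ω₂ lam β γ).gibbsMeasure n T) =
      T * ∫ z, (Φ z.1 - c) ^ 2 ∂((pinnedChain ω₂ lam β γ).gibbsMeasure n T)) := by
  set P := pinnedChain ω₂ lam β γ with hP
  set μ := P.gibbsMeasure n T with hμ
  haveI : IsProbabilityMeasure μ := pinnedChain_isProbabilityMeasure_gibbsMeasure hω hl hβ γ n hT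
  have hH0 : ∀ z, 0 ≤ P.hamiltonian n z := fun z => pinnedChain_hamiltonian_nonneg hω.le hl hβ γ n z
  have hX : ∀ z, 1 ≤ 1 + P.hamiltonian n z := fun z => by linarith [hH0 z]
  -- the centred observable `Ψ = Φ - c`
  obtain ⟨Ψ, hΨ⟩ : ∃ Ψ : (Fin n → ℝ) → ℝ, ∀ q, Ψ q = Φ q - c := ⟨fun q => Φ q - c, fun _ => rfl⟩
  have hΨc : Continuous Ψ := by rw [show Ψ = fun q => Φ q - c from funext hΨ]; exact hΦc.sub continuous_const
  have hΨb : ∀ z : PhaseSpace n, |Ψ z.1| ≤ (C + |c|) * (1 + P.hamiltonian n z) ^ 1 := fun z => by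
    rw [hΨ, pow_one]
    calc |Φ z.1 - c| ≤ |Φ z.1| + |c| := abs_sub _ _
      _ ≤ C * (1 + P.hamiltonian n z) + |c| * (1 + P.hamiltonian n z) :=
          add_le_add (hΦ z) (le_mul_of_one_le_right (abs_nonneg c) (hX z))
      _ = (C + |c|) * (1 + P.hamiltonian n z) := by ring
  have hΦb : ∀ z : PhaseSpace n, |Φ z.1| ≤ C * (1 + P.hamiltonian n z) ^ 1 := fun z => by rw [pow_one]; exact hΦ z
  have hhb : ∀ z : PhaseSpace n, |h z.1| ≤ C * (1 + P.hamiltonian n z) ^ 1 := fun z => by rw [pow_one]; exact hh z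
  have hpb : ∀ (z : PhaseSpace n) (l : Fin n), |z.2 l| ≤ 1 * (1 + P.hamiltonian n z) ^ 1 := fun z l => by
    rw [pow_one, one_mul]; exact abs_momentum_le hω.le hl hβ γ n z l
  -- pointwise bounds of the products that occur
  have bΨ2 : ∀ z : PhaseSpace n, |Ψ z.1| ≤ (C + |c|) * (1 + P.hamiltonian n z) ^ 2 := fun z =>
    statics_abs_le_pow_mono (hX z) (by norm_num) (hΨb z)
  have bΨΨ : ∀ z : PhaseSpace n, |Ψ z.1 * Ψ z.1| ≤ (C + |c|) * (C + |c|) * (1 + P.hamiltonian n z) ^ 2 :=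
    fun z => statics_abs_mul_le (hΨb z) (hΨb z)
  have bΨΦ : ∀ z : PhaseSpace n, |Ψ z.1 * Φ z.1| ≤ (C + |c|) * C * (1 + P.hamiltonian n z) ^ 2 :=
    fun z => statics_abs_mul_le (hΨb z) (hΦb z)
  have bΨh : ∀ z : PhaseSpace n, |Ψ z.1 * h z.1| ≤ (C + |c|) * C * (1 + P.hamiltonian n z) ^ 2 :=
    fun z => statics_abs_mul_le (hΨb z) (hhb z)
  have bpΨg : ∀ z : PhaseSpace n, |z.2 j * (Ψ z.1 * g z.1)| ≤
      1 * ((C + |c|) * C) * (1 + P.hamiltonian n z) ^ (1 + (1 + 2)) :=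
    fun z => statics_abs_mul_le (hpb z j) (statics_abs_mul_le (hΨb z) (hg z))
  have bpΨk : ∀ z : PhaseSpace n, |z.2 j * (Ψ z.1 * k z.1)| ≤
      1 * ((C + |c|) * C) * (1 + P.hamiltonian n z) ^ (1 + (1 + 2)) :=
    fun z => statics_abs_mul_le (hpb z j) (statics_abs_mul_le (hΨb z) (hk z))
  have bp2Ψ : ∀ z : PhaseSpace n, |z.2 j ^ 2 * Ψ z.1| ≤ 1 * 1 * (C + |c|) * (1 + P.hamiltonian n z) ^ (1 + 1 + 1) :=
    fun z => by rw [sq]; exact statics_abs_mul_le (statics_abs_mul_le (hpb z j) (hpb z j)) (hΨb z)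
  have bp2ΨΦ : ∀ z : PhaseSpace n, |z.2 j ^ 2 * (Ψ z.1 * Φ z.1)| ≤
      1 * 1 * ((C + |c|) * C) * (1 + P.hamiltonian n z) ^ (1 + 1 + 2) :=
    fun z => by rw [sq]; exact statics_abs_mul_le (statics_abs_mul_le (hpb z j) (hpb z j)) (bΨΦ z)
  have bppΨh : ∀ z : PhaseSpace n, |z.2 j * z.2 i * (Ψ z.1 * h z.1)| ≤
      1 * 1 * ((C + |c|) * C) * (1 + P.hamiltonian n z) ^ (1 + 1 + 2) :=
    fun z => statics_abs_mul_le (statics_abs_mul_le (hpb z j) (hpb z i)) (bΨh z)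
  -- integrability of the pieces under `μ`
  have hpc : ∀ l : Fin n, Continuous fun z : PhaseSpace n => z.2 l := fun l => by fun_prop
  have hΨc' : Continuous fun z : PhaseSpace n => Ψ z.1 := hΨc.comp continuous_fst
  have hΦc' : Continuous fun z : PhaseSpace n => Φ z.1 := hΦc.comp continuous_fst
  have IΦ : Integrable (fun z : PhaseSpace n => Φ z.1) μ := statics_integrable_of_le_pow hω hl hβ γ n hT 1 hΦc' hΦb
  have IΨ : Integrable (fun z : PhaseSpace n => Ψ z.1) μ := statics_integrable_of_le_pow hω hl hβ γ n hT 1 hΨc' hΨb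
  have IΨΨ : Integrable (fun z : PhaseSpace n => Ψ z.1 * Ψ z.1) μ :=
    statics_integrable_of_le_pow hω hl hβ γ n hT 2 (hΨc'.mul hΨc') bΨΨ
  have IpΨg : Integrable (fun z : PhaseSpace n => z.2 j * (Ψ z.1 * g z.1)) μ :=
    statics_integrable_of_le_pow hω hl hβ γ n hT _ ((hpc j).mul (hΨc'.mul (hgc.comp continuous_fst))) bpΨg
  have IpΨk : Integrable (fun z : PhaseSpace n => z.2 j * (Ψ z.1 * k z.1)) μ :=
    statics_integrable_of_le_pow hω hl hβ γ n hT _ ((hpc j).mul (hΨc'.mul (hkc.comp continuous_fst))) bpΨk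
  have Ip2Ψ : Integrable (fun z : PhaseSpace n => z.2 j ^ 2 * Ψ z.1) μ :=
    statics_integrable_of_le_pow hω hl hβ γ n hT _ (((hpc j).pow 2).mul hΨc') bp2Ψ
  have Ip2ΨΦ : Integrable (fun z : PhaseSpace n => z.2 j ^ 2 * (Ψ z.1 * Φ z.1)) μ :=
    statics_integrable_of_le_pow hω hl hβ γ n hT _ (((hpc j).pow 2).mul (hΨc'.mul hΦc')) bp2ΨΦ
  have IppΨh : Integrable (fun z : PhaseSpace n => z.2 j * z.2 i * (Ψ z.1 * h z.1)) μ :=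
    statics_integrable_of_le_pow hω hl hβ γ n hT _ (((hpc j).mul (hpc i)).mul (hΨc'.mul (hhc.comp continuous_fst)))
      bppΨh
  -- the elementary Gaussian integrals
  have iΨ : ∫ z, Ψ z.1 ∂μ = 0 := by
    have e : ∫ z, Ψ z.1 ∂μ = ∫ z, (Φ z.1 - c) ∂μ := integral_congr_ae (Eventually.of_forall fun z => hΨ z.1)
    rw [e, integral_sub IΦ (integrable_const c), integral_const, hc]
    simp
  have iΨΦ : ∫ z, Ψ z.1 * Φ z.1 ∂μ = ∫ z, (Φ z.1 - c) ^ 2 ∂μ := by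
    have e : ∫ z, Ψ z.1 * Φ z.1 ∂μ = ∫ z, (Ψ z.1 * Ψ z.1 + c * Ψ z.1) ∂μ :=
      integral_congr_ae (Eventually.of_forall fun z => by simp only [hΨ]; ring)
    rw [e, integral_add IΨΨ (IΨ.const_mul c), integral_const_mul, iΨ, mul_zero, add_zero]
    exact integral_congr_ae (Eventually.of_forall fun z => by simp only [hΨ]; ring)
  have i1 : ∫ z, z.2 j ^ 2 * Ψ z.1 ∂μ = 0 := by
    rw [statics_integral_momentum_sq_mul_posFun hω hl hβ γ n hT j hΨc bΨ2, iΨ, mul_zero]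
  have i2 : ∫ z, z.2 j * (Ψ z.1 * g z.1) ∂μ = 0 :=
    statics_integral_momentum_mul_posFun γ n T j (fun q => Ψ q * g q)
  have i3 : ∫ z, z.2 j ^ 2 * (Ψ z.1 * Φ z.1) ∂μ = T * ∫ z, (Φ z.1 - c) ^ 2 ∂μ := by
    have e : ∫ z, z.2 j ^ 2 * (Ψ z.1 * Φ z.1) ∂μ = T * ∫ z, Ψ z.1 * Φ z.1 ∂μ :=
      statics_integral_momentum_sq_mul_posFun hω hl hβ γ n hT j (G := fun q => Ψ q * Φ q) (hΨc.mul hΦc) bΨΦ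
    rw [e, iΨΦ]
  have i4 : ∫ z, z.2 j * z.2 i * (Ψ z.1 * h z.1) ∂μ = 0 :=
    statics_integral_momentum_mul_momentum_mul_posFun hω hl hβ γ n hT hij (G := fun q => Ψ q * h q)
      (hΨc.mul hhc) bΨh
  have i5 : ∫ z, z.2 j * (Ψ z.1 * k z.1) ∂μ = 0 :=
    statics_integral_momentum_mul_posFun γ n T j (fun q => Ψ q * k q)
  have i6 : ∫ z, z.2 j ^ 2 * (Ψ z.1 * Ψ z.1) ∂μ = T * ∫ z, (Φ z.1 - c) ^ 2 ∂μ := by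
    have e : ∫ z, z.2 j ^ 2 * (Ψ z.1 * Ψ z.1) ∂μ = T * ∫ z, Ψ z.1 * Ψ z.1 ∂μ :=
      statics_integral_momentum_sq_mul_posFun hω hl hβ γ n hT j (G := fun q => Ψ q * Ψ q) (hΨc.mul hΨc) bΨΨ
    rw [e]
    congr 1
    exact integral_congr_ae (Eventually.of_forall fun z => by simp only [hΨ]; ring)
  refine ⟨?_, ?_, ?_, ?_⟩
  · have e : ∫ z, (z.2 j * (Φ z.1 - c)) * z.2 j ∂μ = ∫ z, z.2 j ^ 2 * Ψ z.1 ∂μ :=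
      integral_congr_ae (Eventually.of_forall fun z => by simp only [hΨ]; ring)
    rw [e, i1]
  · have e : ∫ z, (z.2 j * (Φ z.1 - c)) * (g z.1 - γ' * z.2 j) ∂μ =
        ∫ z, (z.2 j * (Ψ z.1 * g z.1) - γ' * (z.2 j ^ 2 * Ψ z.1)) ∂μ :=
      integral_congr_ae (Eventually.of_forall fun z => by simp only [hΨ]; ring)
    rw [e, integral_sub IpΨg (Ip2Ψ.const_mul γ'), integral_const_mul, i2, i1]
    ring
  · have e : ∫ z, (z.2 j * (Φ z.1 - c)) * (-(z.2 j * Φ z.1) + z.2 i * h z.1 + γ' * k z.1 + γ' ^ 2 * z.2 j) ∂μ =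
        ∫ z, (-(z.2 j ^ 2 * (Ψ z.1 * Φ z.1)) + z.2 j * z.2 i * (Ψ z.1 * h z.1) + γ' * (z.2 j * (Ψ z.1 * k z.1)) +
          γ' ^ 2 * (z.2 j ^ 2 * Ψ z.1)) ∂μ :=
      integral_congr_ae (Eventually.of_forall fun z => by simp only [hΨ]; ring)
    have I1 : Integrable (fun z : PhaseSpace n => -(z.2 j ^ 2 * (Ψ z.1 * Φ z.1))) μ := Ip2ΨΦ.neg
    have I12 : Integrable (fun z : PhaseSpace n => -(z.2 j ^ 2 * (Ψ z.1 * Φ z.1)) +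
        z.2 j * z.2 i * (Ψ z.1 * h z.1)) μ := I1.add IppΨh
    have I3 : Integrable (fun z : PhaseSpace n => γ' * (z.2 j * (Ψ z.1 * k z.1))) μ := IpΨk.const_mul γ'
    have I123 : Integrable (fun z : PhaseSpace n => -(z.2 j ^ 2 * (Ψ z.1 * Φ z.1)) +
        z.2 j * z.2 i * (Ψ z.1 * h z.1) + γ' * (z.2 j * (Ψ z.1 * k z.1))) μ := I12.add I3
    have I4 : Integrable (fun z : PhaseSpace n => γ' ^ 2 * (z.2 j ^ 2 * Ψ z.1)) μ := Ip2Ψ.const_mul (γ' ^ 2)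
    rw [e, integral_add I123 I4, integral_add I12 I3, integral_add I1 IppΨh, integral_neg, integral_const_mul,
      integral_const_mul, i3, i4, i5, i1]
    ring
  · have e : ∫ z, (z.2 j * (Φ z.1 - c)) ^ 2 ∂μ = ∫ z, z.2 j ^ 2 * (Ψ z.1 * Ψ z.1) ∂μ :=
      integral_congr_ae (Eventually.of_forall fun z => by simp only [hΨ]; ring)
    rw [e, i6]

end Tools

/-! ### The concrete observables of the strict-absorption skeleton -/

section Concrete

variable {ω₂ lam β : ℝ} (hω : 0 < ω₂) (hl : 0 < lam) (hβ : 0 < β) (γ : ℝ) {N : ℕ} (hN : 2 ≤ N)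
include hω hl hβ

/-- The local curvature `Φ = ω₂ + 3 lam q₀² + 1 + 3β (q₁ - q₀)²` is `O(1+H)`:
`|Φ| ≤ (ω₂ + 1 + 6 lam/ω₂ + 6β)(1 + H)` (`ω₂ q₀² ≤ 2H`, `(q₁ - q₀)² ≤ 2H`). [folklore] -/
theorem statics_abs_curvature_le (z : PhaseSpace (N + 1)) :
    |ω₂ + 3 * lam * z.1 0 ^ 2 + 1 + 3 * β * (z.1 ⟨1, by omega⟩ - z.1 0) ^ 2| ≤
      (ω₂ + 1 + 6 * lam / ω₂ + 6 * β) * (1 + (pinnedChain ω₂ lam β γ).hamiltonian (N + 1) z) := by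
  set H := (pinnedChain ω₂ lam β γ).hamiltonian (N + 1) z with hH
  have hH0 : 0 ≤ H := pinnedChain_hamiltonian_nonneg hω.le hl.le hβ.le γ (N + 1) z
  have hU := pinnedChain_U_le_hamiltonian hω.le hl.le hβ.le γ (N + 1) z 0
  have hB := pinnedChain_bond_le_hamiltonian hω.le hl.le hβ.le γ (N + 1) z (i := 0) (j := ⟨1, by omega⟩) (by simp)
  set r := z.1 ⟨1, by omega⟩ - z.1 0 with hr
  have hq4 : 0 ≤ lam * z.1 0 ^ 4 / 4 := by positivity
  have hr4 : 0 ≤ β * r ^ 4 / 4 := by positivity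
  have hq2 : ω₂ * z.1 0 ^ 2 ≤ 2 * H := by linarith
  have hr2 : r ^ 2 ≤ 2 * H := by linarith
  have hlq : lam * z.1 0 ^ 2 ≤ lam / ω₂ * (2 * H) := by
    have e : lam * z.1 0 ^ 2 = lam / ω₂ * (ω₂ * z.1 0 ^ 2) := by field_simp
    rw [e]
    exact mul_le_mul_of_nonneg_left hq2 (div_nonneg hl.le hω.le)
  have hpos : 0 ≤ ω₂ + 3 * lam * z.1 0 ^ 2 + 1 + 3 * β * r ^ 2 := by positivity
  rw [abs_of_nonneg hpos]
  have hlω : 0 ≤ lam / ω₂ := div_nonneg hl.le hω.le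
  have h1 : 3 * lam * z.1 0 ^ 2 ≤ 6 * (lam / ω₂) * H := by linarith
  have h2 : 3 * β * r ^ 2 ≤ 6 * β * H := by
    have := mul_le_mul_of_nonneg_left hr2 hβ.le
    linarith
  have h3 : 0 ≤ (ω₂ + 1) * H := by positivity
  have h4 : ω₂ + 1 + 6 * (lam / ω₂) * H + 6 * β * H ≤ (ω₂ + 1 + 6 * lam / ω₂ + 6 * β) * (1 + H) := by
    have e : (ω₂ + 1 + 6 * lam / ω₂ + 6 * β) * (1 + H) =
        (ω₂ + 1 + 6 * (lam / ω₂) * H + 6 * β * H) + ((ω₂ + 1) * H + 6 * (lam / ω₂) + 6 * β) := by ring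
    rw [e]
    have : 0 ≤ (ω₂ + 1) * H + 6 * (lam / ω₂) + 6 * β := by positivity
    linarith
  linarith

/-- The bond curvature `h = 1 + 3β (q₁ - q₀)²` is `O(1+H)`: `|h| ≤ (1 + 6β)(1 + H)`. [folklore] -/
theorem statics_abs_bondCurvature_le (z : PhaseSpace (N + 1)) :
    |1 + 3 * β * (z.1 ⟨1, by omega⟩ - z.1 0) ^ 2| ≤ (1 + 6 * β) * (1 + (pinnedChain ω₂ lam β γ).hamiltonian (N + 1) z) := by
  set H := (pinnedChain ω₂ lam β γ).hamiltonian (N + 1) z with hH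
  have hH0 : 0 ≤ H := pinnedChain_hamiltonian_nonneg hω.le hl.le hβ.le γ (N + 1) z
  have hB := pinnedChain_bond_le_hamiltonian hω.le hl.le hβ.le γ (N + 1) z (i := 0) (j := ⟨1, by omega⟩) (by simp)
  set r := z.1 ⟨1, by omega⟩ - z.1 0 with hr
  have hr4 : 0 ≤ β * r ^ 4 / 4 := by positivity
  have hr2 : r ^ 2 ≤ 2 * H := by linarith
  have hpos : 0 ≤ 1 + 3 * β * r ^ 2 := by positivity
  rw [abs_of_nonneg hpos]
  nlinarith [mul_le_mul_of_nonneg_left hr2 hβ.le, mul_nonneg hβ.le hH0]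

/-- The forces at the kicked site are `O((1+H)²)`: with `A = ω₂ (1/2 + 1/ω₂) + lam (1/ω₂ + 2/ω₂²) + (3 + β)`,
`|ω₂ q₀ + lam q₀³| + |V'(q₁ - q₀)| ≤ A (1 + H)²`. [folklore] -/
theorem statics_abs_forces_le (z : PhaseSpace (N + 1)) :
    |ω₂ * z.1 0 + lam * z.1 0 ^ 3| + |(z.1 ⟨1, by omega⟩ - z.1 0) + β * (z.1 ⟨1, by omega⟩ - z.1 0) ^ 3| ≤
      (ω₂ * (1 / 2 + 1 / ω₂) + lam * (1 / ω₂ + 2 / ω₂ ^ 2) + (3 + β)) *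
        (1 + (pinnedChain ω₂ lam β γ).hamiltonian (N + 1) z) ^ 2 := by
  set H := (pinnedChain ω₂ lam β γ).hamiltonian (N + 1) z with hH
  have hH0 : 0 ≤ H := pinnedChain_hamiltonian_nonneg hω.le hl.le hβ.le γ (N + 1) z
  have hX : 1 ≤ 1 + H := by linarith
  have h1 := abs_fst_le hω hl.le hβ.le γ z 0
  have h3 := abs_fst_cube_le hω hl.le hβ.le γ z 0
  have hB := pinnedChain_bond_le_hamiltonian hω.le hl.le hβ.le γ (N + 1) z (i := 0) (j := ⟨1, by omega⟩) (by simp)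
  have hV := abs_deriv_V_le hβ.le hB
  have hsq : 1 + H ≤ (1 + H) ^ 2 := by nlinarith
  have hA1 : 0 ≤ ω₂ * (1 / 2 + 1 / ω₂) := by positivity
  have hA3 : 0 ≤ 3 + β := by linarith [hβ.le]
  calc |ω₂ * z.1 0 + lam * z.1 0 ^ 3| + |(z.1 ⟨1, by omega⟩ - z.1 0) + β * (z.1 ⟨1, by omega⟩ - z.1 0) ^ 3|
      ≤ (|ω₂ * z.1 0| + |lam * z.1 0 ^ 3|) + (3 + β) * (1 + H) := add_le_add (abs_add_le _ _) hV
    _ = ω₂ * |z.1 0| + lam * |z.1 0 ^ 3| + (3 + β) * (1 + H) := by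
        rw [abs_mul, abs_mul, abs_of_pos hω, abs_of_pos hl]
    _ ≤ ω₂ * ((1 / 2 + 1 / ω₂) * (1 + H)) + lam * ((1 / ω₂ + 2 / ω₂ ^ 2) * (1 + H) ^ 2) + (3 + β) * (1 + H) := by
        gcongr
    _ = ω₂ * (1 / 2 + 1 / ω₂) * (1 + H) + lam * (1 / ω₂ + 2 / ω₂ ^ 2) * (1 + H) ^ 2 + (3 + β) * (1 + H) := by ring
    _ ≤ ω₂ * (1 / 2 + 1 / ω₂) * (1 + H) ^ 2 + lam * (1 / ω₂ + 2 / ω₂ ^ 2) * (1 + H) ^ 2 + (3 + β) * (1 + H) ^ 2 := by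
        gcongr
    _ = _ := by ring

end Concrete

/-- SUB-GOAL K4b (Gaussian-momentum statics of the Gibbs measure): with `Φ̃ = Φ - ⟨Φ⟩`, `a = p_0 Φ̃`: `⟨a, p_0⟩ = 0`, `⟨a, G₁⟩ = 0`, `⟨a, G₂⟩ = -T Var(Φ)`, `‖a‖² = T Var(Φ)`. [folklore] -/
theorem sa_statics :
    ∀ ω₂ lam β γ : ℝ, 0 < ω₂ → 0 < lam → 0 < β → 0 < γ → ∀ T : ℝ, 0 < T → ∀ (N : ℕ) (hN : 2 ≤ N), (∫ z, (z.2 0 * ((ω₂ + 3 * lam * z.1 0 ^ 2 + 1 + 3 * β * (z.1 ⟨1, by omega⟩ - z.1 0) ^ 2) - ∫ x, (ω₂ + 3 * lam * x.1 0 ^ 2 + 1 + 3 * β * (x.1 ⟨1, by omega⟩ - x.1 0) ^ 2) ∂((pinnedChain ω₂ lam β γ).gibbsMeasure (N + 1) T))) * z.2 0 ∂((pinnedChain ω₂ lam β γ).gibbsMeasure (N + 1) T) = 0) ∧ (∫ z, (z.2 0 * ((ω₂ + 3 * lam * z.1 0 ^ 2 + 1 + 3 * β * (z.1 ⟨1,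 by omega⟩ - z.1 0) ^ 2) - ∫ x, (ω₂ + 3 * lam * x.1 0 ^ 2 + 1 + 3 * β * (x.1 ⟨1, by omega⟩ - x.1 0) ^ 2) ∂((pinnedChain ω₂ lam β γ).gibbsMeasure (N + 1) T))) * (-(ω₂ * z.1 0 + lam * z.1 0 ^ 3) + ((z.1 ⟨1, by omega⟩ - z.1 0) + β * (z.1 ⟨1, by omega⟩ - z.1 0) ^ 3) - γ * z.2 0) ∂((pinnedChain ω₂ lam β γ).gibbsMeasure (N + 1) T) = 0) ∧ (∫ z, (z.2 0 * ((ω₂ + 3 * lam * z.1 0 ^ 2 + 1 + 3 * β * (z.1 ⟨1, by omega⟩ - z.1 0) ^ 2) - ∫ x, (ω₂ + 3 * lam * x.1 0 ^ 2 + 1 + 3 * β * (x.1 ⟨1, by omega⟩ - x.1 0) ^ 2) ∂((pinnedChain ω₂ lam β γ).gibbsMeasure (N + 1) T))) * (-(z.2 0 * (ω₂ + 3 * lam * z.1 0 ^ 2 + 1 + 3 * β * (z.1 ⟨1, by omega⟩ - z.1 0) ^ 2)) + z.2 ⟨1, by omega⟩ * (1 + 3 * β * (z.1 ⟨1, by omega⟩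 - z.1 0) ^ 2) + γ * (ω₂ * z.1 0 + lam * z.1 0 ^ 3 - ((z.1 ⟨1, by omega⟩ - z.1 0) + β * (z.1 ⟨1, by omega⟩ - z.1 0) ^ 3)) + γ ^ 2 * z.2 0) ∂((pinnedChain ω₂ lam β γ).gibbsMeasure (N + 1) T) = -(T * ∫ z, ((ω₂ + 3 * lam * z.1 0 ^ 2 + 1 + 3 * β * (z.1 ⟨1, by omega⟩ - z.1 0) ^ 2) - ∫ x, (ω₂ + 3 * lam * x.1 0 ^ 2 + 1 + 3 * β * (x.1 ⟨1, by omega⟩ - x.1 0) ^ 2) ∂((pinnedChain ω₂ lam β γ).gibbsMeasure (N + 1) T)) ^ 2 ∂((pinnedChain ω₂ lam β γ).gibbsMeasure (N + 1) T))) ∧ (∫ z, (z.2 0 * ((ω₂ + 3 * lam * z.1 0 ^ 2 + 1 + 3 * β * (z.1 ⟨1, by omega⟩ - z.1 0) ^ 2) - ∫ x, (ω₂ + 3 * lam * x.1 0 ^ 2 + 1 + 3 * β * (x.1 ⟨1, by omega⟩ - x.1 0) ^ 2) ∂((pinnedChain ω₂ lam β γ).gibbsMeasure (N + 1) T))) ^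 2 ∂((pinnedChain ω₂ lam β γ).gibbsMeasure (N + 1) T) = T * ∫ z, ((ω₂ + 3 * lam * z.1 0 ^ 2 + 1 + 3 * β * (z.1 ⟨1, by omega⟩ - z.1 0) ^ 2) - ∫ x, (ω₂ + 3 * lam * x.1 0 ^ 2 + 1 + 3 * β * (x.1 ⟨1, by omega⟩ - x.1 0) ^ 2) ∂((pinnedChain ω₂ lam β γ).gibbsMeasure (N + 1) T)) ^ 2 ∂((pinnedChain ω₂ lam β γ).gibbsMeasure (N + 1) T)) := by
  intro ω₂ lam β γ hω hl hβ _hγ T hT N hN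
  -- sizes of the four concrete position observables
  set A : ℝ := ω₂ * (1 / 2 + 1 / ω₂) + lam * (1 / ω₂ + 2 / ω₂ ^ 2) + (3 + β) with hA
  set C : ℝ := (ω₂ + 1 + 6 * lam / ω₂ + 6 * β) + A with hC
  have hA0 : 0 ≤ A := by
    have h1 : 0 ≤ ω₂ * (1 / 2 + 1 / ω₂) := by positivity
    have h2 : 0 ≤ lam * (1 / ω₂ + 2 / ω₂ ^ 2) := by positivity
    have h3 : 0 ≤ 3 + β := by linarith [hβ.le]
    linarith
  have hC1 : ω₂ + 1 + 6 * lam / ω₂ + 6 * β ≤ C := by linarith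
  have hC2 : 1 + 6 * β ≤ C := by
    have : 0 ≤ 6 * lam / ω₂ := by positivity
    linarith [hω.le]
  have hC3 : A ≤ C := by
    have : 0 ≤ 6 * lam / ω₂ := by positivity
    linarith [hω.le, hβ.le]
  have hH0 : ∀ z : PhaseSpace (N + 1), 0 ≤ (pinnedChain ω₂ lam β γ).hamiltonian (N + 1) z := fun z =>
    pinnedChain_hamiltonian_nonneg hω.le hl.le hβ.le γ (N + 1) z
  have hΦ : ∀ z : PhaseSpace (N + 1),
      |(fun q : Fin (N + 1) → ℝ => ω₂ + 3 * lam * q 0 ^ 2 + 1 + 3 * β * (q ⟨1, by omega⟩ - q 0) ^ 2) z.1| ≤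
        C * (1 + (pinnedChain ω₂ lam β γ).hamiltonian (N + 1) z) := fun z =>
    (statics_abs_curvature_le hω hl hβ γ hN z).trans (mul_le_mul_of_nonneg_right hC1 (by linarith [hH0 z]))
  have hh : ∀ z : PhaseSpace (N + 1),
      |(fun q : Fin (N + 1) → ℝ => 1 + 3 * β * (q ⟨1, by omega⟩ - q 0) ^ 2) z.1| ≤
        C * (1 + (pinnedChain ω₂ lam β γ).hamiltonian (N + 1) z) := fun z =>
    (statics_abs_bondCurvature_le hω hl hβ γ hN z).trans (mul_le_mul_of_nonneg_right hC2 (by linarith [hH0 z]))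
  have hg : ∀ z : PhaseSpace (N + 1),
      |(fun q : Fin (N + 1) → ℝ => -(ω₂ * q 0 + lam * q 0 ^ 3) + ((q ⟨1, by omega⟩ - q 0) + β * (q ⟨1, by omega⟩ - q 0) ^ 3)) z.1| ≤
        C * (1 + (pinnedChain ω₂ lam β γ).hamiltonian (N + 1) z) ^ 2 := fun z => by
    have h := statics_abs_forces_le hω hl hβ γ hN z
    have h2 : A * (1 + (pinnedChain ω₂ lam β γ).hamiltonian (N + 1) z) ^ 2 ≤
        C * (1 + (pinnedChain ω₂ lam β γ).hamiltonian (N + 1) z) ^ 2 := mul_le_mul_of_nonneg_right hC3 (by positivity)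
    refine le_trans ?_ (h.trans h2)
    simp only
    calc |-(ω₂ * z.1 0 + lam * z.1 0 ^ 3) + ((z.1 ⟨1, by omega⟩ - z.1 0) + β * (z.1 ⟨1, by omega⟩ - z.1 0) ^ 3)|
        ≤ |-(ω₂ * z.1 0 + lam * z.1 0 ^ 3)| + |(z.1 ⟨1, by omega⟩ - z.1 0) + β * (z.1 ⟨1, by omega⟩ - z.1 0) ^ 3| :=
          abs_add_le _ _
      _ = _ := by rw [abs_neg]
  have hk : ∀ z : PhaseSpace (N + 1),
      |(fun q : Fin (N + 1) → ℝ => ω₂ * q 0 + lam * q 0 ^ 3 - ((q ⟨1, by omega⟩ - q 0) + β * (q ⟨1, by omega⟩ - q 0) ^ 3)) z.1| ≤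
        C * (1 + (pinnedChain ω₂ lam β γ).hamiltonian (N + 1) z) ^ 2 := fun z => by
    have h := statics_abs_forces_le hω hl hβ γ hN z
    have h2 : A * (1 + (pinnedChain ω₂ lam β γ).hamiltonian (N + 1) z) ^ 2 ≤
        C * (1 + (pinnedChain ω₂ lam β γ).hamiltonian (N + 1) z) ^ 2 := mul_le_mul_of_nonneg_right hC3 (by positivity)
    refine le_trans ?_ (h.trans h2)
    exact abs_sub _ _
  have hij : (⟨1, by omega⟩ : Fin (N + 1)) ≠ 0 := by simp [Fin.ext_iff]
  exact statics_identities hω hl.le hβ.le γ (N + 1) hT hij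
    (Φ := fun q : Fin (N + 1) → ℝ => ω₂ + 3 * lam * q 0 ^ 2 + 1 + 3 * β * (q ⟨1, by omega⟩ - q 0) ^ 2)
    (g := fun q : Fin (N + 1) → ℝ => -(ω₂ * q 0 + lam * q 0 ^ 3) + ((q ⟨1, by omega⟩ - q 0) + β * (q ⟨1, by omega⟩ - q 0) ^ 3))
    (h := fun q : Fin (N + 1) → ℝ => 1 + 3 * β * (q ⟨1, by omega⟩ - q 0) ^ 2)
    (k := fun q : Fin (N + 1) → ℝ => ω₂ * q 0 + lam * q 0 ^ 3 - ((q ⟨1, by omega⟩ - q 0) + β * (q ⟨1, by omega⟩ - q 0) ^ 3))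
    (by fun_prop) (by fun_prop) (by fun_prop) (by fun_prop) hΦ hh hg hk γ rfl

end Summit.AtomisticToContinuum.FouriersLaw.Theorems.CoherentDephasing.StrictAbsorption

end
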